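import Mathlib
import Summits.Ventures.PercRepro2.ParallelEdgeClasses
import Summits.Ventures.PercRepro2.MixChordWeakest

/-!
# The doubling lemma for the `o`-class at the `D·Z` and `(D·Z)²` normalisers (blind cell
PercRepro2, night-1 g21; proofs/NIGHT1-G21.md §4, §9)

The `o`-class monotone-law rows with the normalisers `D·Z` (**`DZLawO_all`**) and `(D·Z)²`
(**`DZ2LawO_all`**) are equivalent, over the class of all instances, to the corresponding chord rows
`DZChordO_all`, `DZ2ChordO_all` of `MixChordWeakest.lean` — `nLaw_normDZ_of_nMixChord_parallel`,
`nLaw_normDZ2_of_nMixChord_parallel` of `ParallelEdge.lean` with the class transport of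
`ParallelEdgeClasses.lean`; **`DZLawO_all_iff_DZChordO_all`**, **`DZ2LawO_all_iff_DZ2ChordO_all`**,
and the crux from the law rows, **`HCov_all_of_dzLawO_of_exists`**, **`HCov_all_of_dz2LawO_of_exists`**.

Own code; standard axioms.
-/

namespace Summit.Ventures.PercRepro2

open UnionCluster CovForm

namespace ParallelEdge

section Laws

variable (R : Type*) [Field R] [LinearOrder R] [IsStrictOrderedRing R]

/-- **Row (LAW-DZ-o)**: the monotone `D·Z`-law along every root edge of the `o`-class, on all
instances. -/
def DZLawO_all : Prop :=
  ∀ (V E : Type) [Fintype V] [DecidableEq V] [Fintype E] [DecidableEq E]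
    (ends : E → Sym2 V) (p : E → R), IsProbVec p →
    ∀ o a₁ a₂ a₃ b : V, a₁ ≠ a₂ → a₁ ≠ a₃ → a₂ ≠ a₃ → o ≠ a₁ → o ≠ a₂ → o ≠ a₃ → o ≠ b →
      b ≠ a₁ → b ≠ a₂ → b ≠ a₃ →
      ∀ e ∈ Chord.rootEdges p ends a₁ a₂, Mix.OClass p ends o a₁ a₂ e →
        Mix.NLaw (Mix.normDZ ends a₁ a₂ a₃) p ends o a₁ a₂ a₃ b e

/-- **Row (LAW-DZ²-o)**: the monotone `(D·Z)²`-law along every root edge of the `o`-class, on all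
instances. -/
def DZ2LawO_all : Prop :=
  ∀ (V E : Type) [Fintype V] [DecidableEq V] [Fintype E] [DecidableEq E]
    (ends : E → Sym2 V) (p : E → R), IsProbVec p →
    ∀ o a₁ a₂ a₃ b : V, a₁ ≠ a₂ → a₁ ≠ a₃ → a₂ ≠ a₃ → o ≠ a₁ → o ≠ a₂ → o ≠ a₃ → o ≠ b →
      b ≠ a₁ → b ≠ a₂ → b ≠ a₃ →
      ∀ e ∈ Chord.rootEdges p ends a₁ a₂, Mix.OClass p ends o a₁ a₂ e →
        Mix.NLaw (Mix.normDZ2 ends a₁ a₂ a₃) p ends o a₁ a₂ a₃ b e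

/-- **The doubling lemma at `D·Z`: the chord row implies the law row.** -/
theorem DZLawO_all_of_DZChordO_all (h : Mix.DZChordO_all R) : DZLawO_all R := by
  intro V E _ _ _ _ ends p hp o a₁ a₂ a₃ b h12 h13 h23 ho1 ho2 ho3 hob hb1 hb2 hb3 e he hO
  refine nLaw_normDZ_of_nMixChord_parallel (Gc_update_one_eq_zero_of_oClass hO a₃ b) ?_
  intro q₁ r hq₁0 hq₁1 hr0 hr1
  rcases eq_or_lt_of_le hr0 with hr0' | hr0'
  · subst hr0'
    unfold Mix.NMixChord
    rw [pP_update_none_zero, pP_none]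
    simp
  rcases eq_or_lt_of_le hr1 with hr1' | hr1'
  · subst hr1'
    unfold Mix.NMixChord
    rw [pP_update_none_one, pP_none]
    simp
  · exact h V (Option E) (endsP ends e) (pP p e q₁ r) (isProbVec_pP hp hq₁0 hq₁1 hr0 hr1) o a₁ a₂
      a₃ b h12 h13 h23 ho1 ho2 ho3 hob hb1 hb2 hb3 none (none_mem_rootEdges_pP he hr0'.ne' hr1'.ne)
      (oClass_pP (Chord.frac_of_mem_rootEdges he) hr1'.ne hO)

/-- **The doubling lemma at `(D·Z)²`: the chord row implies the law row.** -/
theorem DZ2LawO_all_of_DZ2ChordO_all (h : Mix.DZ2ChordO_all R) : DZ2LawO_all R := by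
  intro V E _ _ _ _ ends p hp o a₁ a₂ a₃ b h12 h13 h23 ho1 ho2 ho3 hob hb1 hb2 hb3 e he hO
  refine nLaw_normDZ2_of_nMixChord_parallel (Gc_update_one_eq_zero_of_oClass hO a₃ b) ?_
  intro q₁ r hq₁0 hq₁1 hr0 hr1
  rcases eq_or_lt_of_le hr0 with hr0' | hr0'
  · subst hr0'
    unfold Mix.NMixChord
    rw [pP_update_none_zero, pP_none]
    simp
  rcases eq_or_lt_of_le hr1 with hr1' | hr1'
  · subst hr1'
    unfold Mix.NMixChord
    rw [pP_update_none_one, pP_none]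
    simp
  · exact h V (Option E) (endsP ends e) (pP p e q₁ r) (isProbVec_pP hp hq₁0 hq₁1 hr0 hr1) o a₁ a₂
      a₃ b h12 h13 h23 ho1 ho2 ho3 hob hb1 hb2 hb3 none (none_mem_rootEdges_pP he hr0'.ne' hr1'.ne)
      (oClass_pP (Chord.frac_of_mem_rootEdges he) hr1'.ne hO)

/-- **The `D·Z`-law row is the `D·Z`-chord row** over the class of all instances. -/
theorem DZLawO_all_iff_DZChordO_all : DZLawO_all R ↔ Mix.DZChordO_all R :=
  ⟨fun h V E _ _ _ _ ends p hp o a₁ a₂ a₃ b h12 h13 h23 ho1 ho2 ho3 hob hb1 hb2 hb3 e he hO =>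
      Mix.nMixChord_of_nLaw hp
        (h V E ends p hp o a₁ a₂ a₃ b h12 h13 h23 ho1 ho2 ho3 hob hb1 hb2 hb3 e he hO),
    DZLawO_all_of_DZChordO_all R⟩

/-- **The `(D·Z)²`-law row is the `(D·Z)²`-chord row** over the class of all instances. -/
theorem DZ2LawO_all_iff_DZ2ChordO_all : DZ2LawO_all R ↔ Mix.DZ2ChordO_all R :=
  ⟨fun h V E _ _ _ _ ends p hp o a₁ a₂ a₃ b h12 h13 h23 ho1 ho2 ho3 hob hb1 hb2 hb3 e he hO =>
      Mix.nMixChord_of_nLaw hp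
        (h V E ends p hp o a₁ a₂ a₃ b h12 h13 h23 ho1 ho2 ho3 hob hb1 hb2 hb3 e he hO),
    DZ2LawO_all_of_DZ2ChordO_all R⟩

/-- **The crux from the `o`-class `D·Z`-law row and the existential (MIX²) row.** -/
theorem HCov_all_of_dzLawO_of_exists (h₁ : DZLawO_all R) (h₂ : Mix.MixChord2ExistsNoO_all R) :
    HCov_all R :=
  Mix.HCov_all_of_dzChordO_of_exists R ((DZLawO_all_iff_DZChordO_all R).1 h₁) h₂

/-- **The crux from the `o`-class `(D·Z)²`-law row and the existential (MIX²) row.** -/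
theorem HCov_all_of_dz2LawO_of_exists (h₁ : DZ2LawO_all R) (h₂ : Mix.MixChord2ExistsNoO_all R) :
    HCov_all R :=
  Mix.HCov_all_of_dz2ChordO_of_exists R ((DZ2LawO_all_iff_DZ2ChordO_all R).1 h₁) h₂

end Laws

end ParallelEdge

end Summit.Ventures.PercRepro2
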